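import Summits.RiemannHypothesis.RiemannHypothesis.Theorems.IntegerScrewScrewPolyFloorLandauPairing
import Summits.RiemannHypothesis.RiemannHypothesis.Theorems.WeilCombCombHelsonBound
import Literature.NumberTheory.LFunctions.LandauGonekFormula
import HarnessLib

/-!
# Route IntegerScrew — Landau sums at the ratios `m/m'` and the Helson form of the main terms

Helper file for crux `IntegerScrew.ScrewPolyFloor` (stmt-RiemannHypothesis-15757): the inputs of the
RH-free window lower bound for the Landau pairing (`IntegerScrewScrewPolyFloorLandauBlock.lean`):

* `landauSum_ratio_bound` — Landau's formula (`LandauGonek.landau_gonek_formula`) at `x = m/m'`,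
  `1 ≤ m' < m ≤ M`, `T ≥ 2`: `‖L(m/m';T) + (T/π)Λ(m/m')‖ ≤ 8 C M⁴ (log T)²`
  (`x ≤ M`, `1/log x ≤ M` (`inv_log_div_le`), `x/⟨x⟩ ≤ M²` (`inv_le_primePowDist_div`));
* `mainTerms_eq_helson`, `two_mul_mainTerms_le` — the von Mangoldt main terms
  `∑_{m,m'} y_m y_m' (√m'/√m) Λ(m/m')` are the route's Helson form
  `∑_{m'} ∑_{n ≤ M/m'} Λ(n) n^{−1/2} y_{nm'} y_{m'}`, hence `2·(main terms) ≤ (log M + 1) ∑ y_m²` by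
  `combHelsonBound_proof`;
* `sq_sum_abs_le` (Cauchy–Schwarz), `sum_sum_eq_half_symm` (symmetrisation of a double sum).
-/

noncomputable section

open Complex Finset
open scoped Real ComplexConjugate

-- the layout-mandated namespace repeats the summit name
set_option linter.dupNamespace false

namespace Summit.RiemannHypothesis.RiemannHypothesis.Theorems.IntegerScrewLandau

open Literature.NumberTheory.LFunctions ArithmeticFunction

/-! ### Arithmetic of the ratios `m/m'` -/

/-- `⟨m/m'⟩ ≥ 1/m'`: a prime power `n ≠ m/m'` is at distance `≥ 1/m'` (the numerator `m − n m'` is a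
non-zero integer). [folklore] -/
theorem inv_le_primePowDist_div {m m' : ℕ} (hm' : 1 ≤ m') :
    (1 : ℝ) / m' ≤ primePowDist ((m : ℝ) / m') := by
  have hm'0 : (0 : ℝ) < m' := by exact_mod_cast hm'
  unfold primePowDist
  refine le_ciInf fun n ↦ ?_
  obtain ⟨n, -, hne⟩ := n
  dsimp only
  have hint : ((m : ℤ) - n * m' : ℤ) ≠ 0 := by
    intro h
    apply hne
    have h' : (m : ℝ) - n * m' = 0 := by exact_mod_cast h
    field_simp
    linarith
  have h1 : (1 : ℝ) ≤ |(((m : ℤ) - n * m' : ℤ) : ℝ)| := by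
    rw [← Int.cast_abs]; exact_mod_cast Int.one_le_abs hint
  have e : (m : ℝ) / m' - n = (((m : ℤ) - n * m' : ℤ) : ℝ) / m' := by
    push_cast
    field_simp
  rw [e, abs_div, abs_of_pos hm'0]
  exact div_le_div_of_nonneg_right h1 hm'0.le

/-- `1/log(m/m') ≤ M` for `1 ≤ m' < m ≤ M` (`log x ≥ 1 − 1/x = (m − m')/m ≥ 1/M`). [folklore] -/
theorem inv_log_div_le {M m m' : ℕ} (hm' : 1 ≤ m') (hlt : m' < m) (hmM : m ≤ M) :
    1 / Real.log ((m : ℝ) / m') ≤ M := by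
  have hm0 : (0 : ℝ) < m := Nat.cast_pos.2 (lt_of_lt_of_le (Nat.lt_of_succ_le hm') hlt.le)
  have hm'0 : (0 : ℝ) < m' := by exact_mod_cast hm'
  have hM0 : (0 : ℝ) < M := Nat.cast_pos.2 (lt_of_lt_of_le (Nat.lt_of_succ_le hm') (hlt.le.trans hmM))
  have h1 : (1 : ℝ) ≤ (m : ℝ) - m' := by
    have : (m' : ℝ) + 1 ≤ m := by exact_mod_cast hlt
    linarith
  have hlog : ((m : ℝ) - m') / m ≤ Real.log ((m : ℝ) / m') := by
    have h := Real.one_sub_inv_le_log_of_pos (div_pos hm0 hm'0)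
    rw [inv_div] at h
    have e : 1 - (m' : ℝ) / m = ((m : ℝ) - m') / m := by field_simp
    rwa [e] at h
  have hpos : 0 < ((m : ℝ) - m') / m := by positivity
  have hmM' : (m : ℝ) ≤ M := by exact_mod_cast hmM
  calc 1 / Real.log ((m : ℝ) / m') ≤ 1 / (((m : ℝ) - m') / m) :=
        one_div_le_one_div_of_le hpos hlog
    _ = m / ((m : ℝ) - m') := by rw [one_div_div]
    _ ≤ M / 1 := div_le_div₀ hM0.le hmM' one_pos h1
    _ = M := div_one _

/-! ### The Landau sums `L(x;T)` for `x = m/m'` -/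

/-- **Landau's formula at the ratios.** With `C` the constant of `landau_gonek_formula`: for
`1 ≤ m' < m ≤ M` and `T ≥ 2`,
`‖L(m/m'; T) + (T/π) Λ(m/m')‖ ≤ 8 C M⁴ (log T)²` (`x ≤ M`, `1/log x ≤ M`, `x/⟨x⟩ ≤ M²`,
`1 ≤ 4 log²T`). [folklore] -/
theorem landauSum_ratio_bound {C : ℝ} (hC0 : 0 < C)
    (hC : ∀ x : ℝ, 1 < x → ∀ T : ℝ, 2 ≤ T →
      ‖∑ ρ ∈ (weilZeroIndex_finite T).toFinset, (riemannZetaZeroOrder ρ : ℂ) * (x : ℂ) ^ ρ +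
          (((T / π * (if ((⌊x⌋₊ : ℕ) : ℝ) = x then Λ ⌊x⌋₊ else 0)) : ℝ) : ℂ)‖ ≤
        C * x ^ 2 * ((1 + 1 / Real.log x) ^ 2 * Real.log T ^ 2 + min T (x / primePowDist x)))
    {M m m' : ℕ} (hm' : 1 ≤ m') (hlt : m' < m) (hmM : m ≤ M) {T : ℝ} (hT : 2 ≤ T) :
    ‖∑ ρ ∈ (weilZeroIndex_finite T).toFinset,
          (riemannZetaZeroOrder ρ : ℂ) * ((((m : ℝ) / m' : ℝ)) : ℂ) ^ ρ +
        (((T / π * (if ((⌊(m : ℝ) / m'⌋₊ : ℕ) : ℝ) = (m : ℝ) / m' then Λ ⌊(m : ℝ) / m'⌋₊ else 0)) : ℝ) : ℂ)‖ ≤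
      8 * C * (M : ℝ) ^ 4 * Real.log T ^ 2 := by
  set x : ℝ := (m : ℝ) / m' with hx
  have hm'0 : (0 : ℝ) < m' := by exact_mod_cast hm'
  have hmm' : (m' : ℝ) < m := by exact_mod_cast hlt
  have hx1 : 1 < x := by rw [hx, one_lt_div hm'0]; exact hmm'
  have hx0 : 0 < x := by linarith
  have hmM' : (m : ℝ) ≤ M := by exact_mod_cast hmM
  have hM1 : (1 : ℝ) ≤ M := by exact_mod_cast le_trans hm' (hlt.le.trans hmM)
  have hxM : x ≤ M := by
    rw [hx, div_le_iff₀ hm'0]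
    calc (m : ℝ) ≤ M := hmM'
      _ = M * 1 := (mul_one _).symm
      _ ≤ M * m' := by gcongr; exact_mod_cast hm'
  have hlogx : 1 / Real.log x ≤ M := inv_log_div_le hm' hlt hmM
  have hpd : x / primePowDist x ≤ (M : ℝ) ^ 2 := by
    have h1 := inv_le_primePowDist_div (m := m) hm'
    have hpos : (0 : ℝ) < 1 / m' := by positivity
    calc x / primePowDist x ≤ x / (1 / m') := div_le_div_of_nonneg_left hx0.le hpos h1
      _ = x * m' := by rw [div_div_eq_mul_div, div_one]
      _ ≤ M * M := by
          refine mul_le_mul hxM (by exact_mod_cast (hlt.le.trans hmM)) hm'0.le (by linarith)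
      _ = (M : ℝ) ^ 2 := by ring
  have hlogT : Real.log 2 ≤ Real.log T := Real.log_le_log two_pos hT
  have hlog2 : (1 / 2 : ℝ) < Real.log 2 := by have := Real.log_two_gt_d9; linarith
  have hlogsq : 1 ≤ 4 * Real.log T ^ 2 := by nlinarith
  have hT0 : 0 < T := by linarith
  refine (hC x hx1 T hT).trans ?_
  have hfac : (1 + 1 / Real.log x) ^ 2 ≤ 4 * (M : ℝ) ^ 2 := by
    have h0 : 0 ≤ 1 / Real.log x := by
      have := Real.log_pos hx1; positivity
    nlinarith
  have hmin : min T (x / primePowDist x) ≤ (M : ℝ) ^ 2 := (min_le_right _ _).trans hpd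
  have hx2 : x ^ 2 ≤ (M : ℝ) ^ 2 := pow_le_pow_left₀ hx0.le hxM 2
  have hlT0 : 0 ≤ Real.log T ^ 2 := sq_nonneg _
  calc C * x ^ 2 * ((1 + 1 / Real.log x) ^ 2 * Real.log T ^ 2 + min T (x / primePowDist x))
      ≤ C * (M : ℝ) ^ 2 * (4 * (M : ℝ) ^ 2 * Real.log T ^ 2 + (M : ℝ) ^ 2) := by
        gcongr
        · exact add_nonneg (by positivity) (le_min hT0.le (by have := primePowDist_pos x; positivity))
    _ ≤ C * (M : ℝ) ^ 2 * (4 * (M : ℝ) ^ 2 * Real.log T ^ 2 + (M : ℝ) ^ 2 * (4 * Real.log T ^ 2)) := by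
        gcongr
        exact le_mul_of_one_le_right (by positivity) hlogsq
    _ = 8 * C * (M : ℝ) ^ 4 * Real.log T ^ 2 := by ring

/-! ### The von Mangoldt main terms: the Helson form -/

/-- `Λ` at a real: `Λ(x) = Λ(n)` if `x = n ∈ ℕ`, else `0` — the main term of `landau_gonek_formula`
at `x = n ∈ ℕ`. [folklore] -/
theorem vonMangoldtReal_natCast (n : ℕ) :
    (if ((⌊(n : ℝ)⌋₊ : ℕ) : ℝ) = (n : ℝ) then Λ ⌊(n : ℝ)⌋₊ else 0) = Λ n := by
  rw [Nat.floor_natCast, if_pos rfl]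

/-- For `0 < x < 1` the main term vanishes. [folklore] -/
theorem vonMangoldtReal_eq_zero_of_lt_one {x : ℝ} (hx0 : 0 < x) (hx1 : x < 1) :
    (if ((⌊x⌋₊ : ℕ) : ℝ) = x then Λ ⌊x⌋₊ else 0) = 0 := by
  rw [Nat.floor_eq_zero.2 hx1, if_neg]
  simp only [Nat.cast_zero]
  exact hx0.ne

/-- For `m' ∤ m` (`m' ≥ 1`) the main term at `m/m'` vanishes. [folklore] -/
theorem vonMangoldtReal_div_eq_zero {m m' : ℕ} (hm' : 1 ≤ m') (h : ¬ m' ∣ m) :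
    (if ((⌊(m : ℝ) / m'⌋₊ : ℕ) : ℝ) = (m : ℝ) / m' then Λ ⌊(m : ℝ) / m'⌋₊ else 0) = 0 := by
  rw [if_neg]
  intro heq
  apply h
  have hm'0 : (m' : ℝ) ≠ 0 := by exact_mod_cast (Nat.one_le_iff_ne_zero.1 hm')
  refine ⟨⌊(m : ℝ) / m'⌋₊, ?_⟩
  have : (m : ℝ) = ⌊(m : ℝ) / m'⌋₊ * m' := by rw [heq]; field_simp
  rw [mul_comm]
  exact_mod_cast this

/-- **The main terms are the Helson form.** For a real vector `y` on `[1, M]`,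
`∑_{m,m' ≤ M} y_m y_m' (√m'/√m) Λ(m/m') = ∑_{m' ≤ M} ∑_{n ≤ M/m'} Λ(n) n^{−1/2} y_{nm'} y_{m'}`
(only the pairs `m = n m'` contribute). [folklore] -/
theorem mainTerms_eq_helson (M : ℕ) (y : ℕ → ℝ) :
    ∑ m ∈ Icc 1 M, ∑ m' ∈ Icc 1 M, y m * y m' * (Real.sqrt m' / Real.sqrt m) *
        (if ((⌊(m : ℝ) / m'⌋₊ : ℕ) : ℝ) = (m : ℝ) / m' then Λ ⌊(m : ℝ) / m'⌋₊ else 0) =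
      ∑ m' ∈ Icc 1 M, ∑ n ∈ Icc 1 (M / m'), Λ n / Real.sqrt n * (y (n * m') * y m') := by
  rw [Finset.sum_comm]
  refine Finset.sum_congr rfl fun m' hm' ↦ ?_
  rw [Finset.mem_Icc] at hm'
  have hm'0 : (0 : ℝ) < m' := by exact_mod_cast hm'.1
  have hinj : Set.InjOn (fun n : ℕ ↦ n * m') ((Icc 1 (M / m') : Finset ℕ) : Set ℕ) :=
    fun a _ b _ h ↦ Nat.eq_of_mul_eq_mul_right hm'.1 h
  -- the image of `n ↦ n m'` inside `[1, M]`
  have himage : (Icc 1 (M / m')).image (fun n : ℕ ↦ n * m') ⊆ Icc 1 M := by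
    intro m hm
    rw [Finset.mem_image] at hm
    obtain ⟨n, hn, rfl⟩ := hm
    rw [Finset.mem_Icc] at hn ⊢
    exact ⟨Nat.mul_le_mul hn.1 hm'.1, (Nat.le_div_iff_mul_le hm'.1).1 hn.2⟩
  set F : ℕ → ℝ := fun m ↦ y m * y m' * (Real.sqrt m' / Real.sqrt m) *
      (if ((⌊(m : ℝ) / m'⌋₊ : ℕ) : ℝ) = (m : ℝ) / m' then Λ ⌊(m : ℝ) / m'⌋₊ else 0) with hF
  have step1 : ∑ n ∈ Icc 1 (M / m'), Λ n / Real.sqrt n * (y (n * m') * y m') =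
      ∑ n ∈ Icc 1 (M / m'), F (n * m') := by
    refine Finset.sum_congr rfl fun n hn ↦ ?_
    rw [Finset.mem_Icc] at hn
    have hn0 : (0 : ℝ) < n := by exact_mod_cast hn.1
    have e1 : ((n * m' : ℕ) : ℝ) / m' = (n : ℝ) := by push_cast; field_simp
    simp only [hF]
    rw [e1, vonMangoldtReal_natCast, Nat.cast_mul, Real.sqrt_mul (Nat.cast_nonneg n)]
    have hs : Real.sqrt m' ≠ 0 := (Real.sqrt_pos.2 hm'0).ne'
    have hsn : Real.sqrt n ≠ 0 := (Real.sqrt_pos.2 hn0).ne'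
    field_simp
  have step2 : ∑ n ∈ Icc 1 (M / m'), F (n * m') =
      ∑ m ∈ (Icc 1 (M / m')).image (fun n : ℕ ↦ n * m'), F m := (Finset.sum_image hinj).symm
  have step3 : ∑ m ∈ (Icc 1 (M / m')).image (fun n : ℕ ↦ n * m'), F m = ∑ m ∈ Icc 1 M, F m := by
    refine Finset.sum_subset himage fun m hm hnot ↦ ?_
    -- off the image: `m' ∤ m`
    have hndvd : ¬ m' ∣ m := by
      intro ⟨k, hk⟩
      apply hnot
      rw [Finset.mem_image]
      rw [Finset.mem_Icc] at hm
      refine ⟨k, ?_, by rw [hk, mul_comm]⟩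
      rw [Finset.mem_Icc]
      constructor
      · rcases Nat.eq_zero_or_pos k with rfl | hk0
        · rw [hk, mul_zero] at hm; omega
        · exact hk0
      · rw [Nat.le_div_iff_mul_le hm'.1, mul_comm, ← hk]; exact hm.2
    simp only [hF]
    rw [vonMangoldtReal_div_eq_zero hm'.1 hndvd, mul_zero]
  exact (step1.trans (step2.trans step3)).symm

/-- **The Helson bound for the main terms** (`combHelsonBound_proof`, real coefficients):
`2 ∑_{m,m' ≤ M} y_m y_m' (√m'/√m) Λ(m/m') ≤ (log M + 1) ∑ y_m²`. [folklore] -/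
theorem two_mul_mainTerms_le {M : ℕ} (hM : 1 ≤ M) (y : ℕ → ℝ) :
    2 * ∑ m ∈ Icc 1 M, ∑ m' ∈ Icc 1 M, y m * y m' * (Real.sqrt m' / Real.sqrt m) *
        (if ((⌊(m : ℝ) / m'⌋₊ : ℕ) : ℝ) = (m : ℝ) / m' then Λ ⌊(m : ℝ) / m'⌋₊ else 0) ≤
      (Real.log M + 1) * ∑ m ∈ Icc 1 M, y m ^ 2 := by
  rw [mainTerms_eq_helson]
  have h := combHelsonBound_proof M (fun k ↦ (y k : ℂ)) hM
  have hre : (∑ m ∈ Icc 1 M, ∑ n ∈ Icc 1 (M / m),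
      ((Λ n : ℝ) : ℂ) / (Real.sqrt n : ℂ) * (y (n * m) : ℂ) * conj (y m : ℂ)).re =
      ∑ m' ∈ Icc 1 M, ∑ n ∈ Icc 1 (M / m'), Λ n / Real.sqrt n * (y (n * m') * y m') := by
    rw [Complex.re_sum]
    refine Finset.sum_congr rfl fun m _ ↦ ?_
    rw [Complex.re_sum]
    refine Finset.sum_congr rfl fun n _ ↦ ?_
    rw [Complex.conj_ofReal]
    have e : ((Λ n : ℝ) : ℂ) / (Real.sqrt n : ℂ) * (y (n * m) : ℂ) * ((y m : ℝ) : ℂ) =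
        ((Λ n / Real.sqrt n * (y (n * m) * y m) : ℝ) : ℂ) := by
      push_cast; ring
    rw [e, Complex.ofReal_re]
  have hnorm : ∑ m ∈ Icc 1 M, ‖(y m : ℂ)‖ ^ 2 = ∑ m ∈ Icc 1 M, y m ^ 2 :=
    Finset.sum_congr rfl fun m _ ↦ by rw [Complex.norm_real, Real.norm_eq_abs, sq_abs]
  rw [hre, hnorm] at h
  exact h

/-- Cauchy–Schwarz: `(∑_{m ≤ M} |y_m|)² ≤ M ∑ y_m²`. [folklore] -/
theorem sq_sum_abs_le (M : ℕ) (y : ℕ → ℝ) :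
    (∑ m ∈ Icc 1 M, |y m|) ^ 2 ≤ M * ∑ m ∈ Icc 1 M, y m ^ 2 := by
  have h := Finset.sum_mul_sq_le_sq_mul_sq (Icc 1 M) (fun _ ↦ (1 : ℝ)) (fun m ↦ |y m|)
  simp only [one_mul, one_pow, Finset.sum_const, Nat.card_Icc, add_tsub_cancel_right, nsmul_eq_mul,
    mul_one, sq_abs] at h
  exact h

/-- Symmetrisation of a double sum over a square. [folklore] -/
theorem sum_sum_eq_half_symm {α : Type*} (s : Finset α) (f : α → α → ℂ) :
    ∑ a ∈ s, ∑ b ∈ s, f a b = (1 / 2 : ℂ) * ∑ a ∈ s, ∑ b ∈ s, (f a b + f b a) := by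
  rw [show ∑ a ∈ s, ∑ b ∈ s, (f a b + f b a) =
      ∑ a ∈ s, ∑ b ∈ s, f a b + ∑ a ∈ s, ∑ b ∈ s, f b a by
    simp only [Finset.sum_add_distrib], Finset.sum_comm (f := fun a b ↦ f b a)]
  ring

end Summit.RiemannHypothesis.RiemannHypothesis.Theorems.IntegerScrewLandau

end
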